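import Summits.ABC.IUTFork.LDHGenuine
import Summits.ABC.IUTFork.LDHWitness
import HarnessLib

/-!
# The fork at [IUTchIII] Corollary 3.12, L-DH level: the PER-PRIME reading of (1.1) FAILS at a deep bad prime

Record-only file (D-0012) of the abc-iut cell (WAVE-5 prover abc-iut-w5-d157; skeleton `HOME/skel/FORK-LOCAL-GLOBAL.md` §3 "ARGUED, NOT
kernel-checked at the real setting" / §6; `HOME/plan/ADJUDICATION-SPEC.md` v2 §2 (G1′) P1); TAKES NO SIDE on Cor. 3.12. The cell's
SUFFICIENT readings of Step (xi-f) of the proof of [IUTchIII] Cor. 3.12 (kurims May 2020 `paper:url-4b091feeb646`, p. 183 l. 43 – p. 184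
l. 29) that quantify PER PACKET `(j, v_ℚ)` (R0/R2/R3/R4, `VolumeTransport`; skeleton XXIV `Cor312Vol.perPlace_bound_of_pointwise`) are
certified STRONGER than the printed GLOBAL inequality at the frozen interfaces (`Cor312Vol.LocalGlobal.fork`) and false in a printed-
coefficient numerical shadow (`LocalGlobalNumbers.localGlobal_numbers`). This file proves the corresponding statement for GENUINE
arithmetic inputs over the Dupuy–Hilado containers of abc-iut-S2 / c312-3 / c312-d1 (every ingredient a theorem, nothing assumed):
* §1 (any `D : DHData F`, any prime `p`): Thm. 3.10.1 at ONE prime — `ln ν̄_{𝕃_p}(O_𝕃(−P_q)_p) = −Q_p`, `ln ν̄_{𝕃_p}(O_𝕃(−P_Θ)_p) =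
  −c_l·Q_p`, `Q_p := deĝ̲(Σ_{v|p} P_q(v)[v]) ≥ 0`, `c_l := (ℓ⋆+1)(2ℓ⋆+1)/6 ≥ 5/2`; so the PER-PRIME READING "`ln ν̄_{𝕃_p}(O_𝕃(−P_q)_p) ≤
  ln ν̄_{𝕃_p}(hull(U_Θ)_p)`" (R0 summed over the packets at `v_ℚ = p` and procession-averaged — implied by the per-packet reading,
  `perPrimeReading_of_perPacketReading`) plus ANY hull bound `ln ν̄_{𝕃_p}(hull(U_Θ)_p) ≤ ln ν̄_{𝕃_p}(O_𝕃(−P_Θ)_p) + δ` forces `(c_l −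
  1)·Q_p ≤ δ` (`perPrime_gap_le`): the local `q`-mass bounded by the Step (v) discrepancy AT `p` ALONE (the abc shape minus every other
  prime's conductor term).
* §2 (`DHData.ofIdelesM`, Mochizuki shell): the per-prime Step (v) hull bound with c312-d1's EXPLICIT discrepancy
  (`componentBound_ofIdelesM`; [IUTchIV] Thm. 1.10 Step (v) pp. 27–28) at ANY prime — `lnνLp_hullUTheta_le_ofIdelesM`.
* §3 (GENUINE `I : ThetaVolumeInput F₀ K`): with `δ_p(I)` the `p`-summand of `explicitDelta I` (`explicitDeltaAt`), the reading
  `I.negAbsLogQLoc p ≤ I.negLogThetaLoc p` forces `(c_l − 1)·Q_p ≤ δ_p(I)` (`perPrime_gap_le_of_reading`).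
* §4 THE DEEP PLACE. `δ_p(I)` is NOT `ord(q)`-free in general: its summand `𝔼_{v⃗}[θ_j(v_j) − min_a θ_j(v_a)]` (Step (v): the hull of the
  `𝔖_{j+1}`-orbit is governed by the SMALLEST slot valuation) is of the size of `c_l·Q_p` when a GOOD place of `F₀` lies over the same
  `p`. With ONE place `v₀` of `F₀` over `p` (e.g. `F₀ = ℚ`, the summit route's `F_mod`) it VANISHES and `δ_p(I) ≤ D_p(I) := ((ℓ⋆+3)/2·d₀ +
  1)·log p + ((ℓ⋆+3)/2)·(3 + log e₀)` is `ord(q)`-FREE (`d₀`, `e₀` = different exponent / ramification index of `K_{v̲₀}`;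
  `explicitDeltaAt_le_of_subsingleton`), so the per-prime — hence every per-packet — reading FAILS at `p` once `(c_l −
  1)·ord_{v₀}(q_{v₀})·ln N(v₀)/(2l·[F₀:ℚ]) > D_p(I)` (`not_perPrimeReading_of_deep`, `not_perPrimeReading_of_ordq_large`), whatever the
  GLOBAL `Cor312Of I` does.
NOT here: the verbatim `Cor312.Setting` (transport of `qLocal/thetaLocal` = c312-5/c312-6 `Real.settingDHVol`, A-line
`not_pointwise_real`); any judgement on Step (xi-f); any claim about Mochizuki's intended objects beyond this arithmetic.
[cite: Mochizuki2012, IUTchIV Thm. 1.10 Step (v) p. 27–28] [cite: DupuyHilado2025, §1 (1.1), Def. 3.6.3, §3.9, Thm. 3.10.1, §4.10–4.12]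
[claim: Mochizuki2012, status: disputed] for every IUT quotation.
-/

noncomputable section

open Set NumberField IsDedekindDomain Literature.IUT.LogVolume

namespace Summit.ABC.IUTFork.DHData

variable {F : Type} [Field F] [NumberField F] (D : DHData F)

/-! ## §1 Thm. 3.10.1 at one prime, and the per-prime squeeze (any Dupuy–Hilado data) -/

/-- **`ln ν̄_{𝕃_p}(O_𝕃(−P_q)_p) = −Q_p`**, `Q_p := deĝ̲(Σ_{v|p} P_q(v)[v])` (Dupuy–Hilado Thm. 3.10.1 (iii) at one prime;
the `q`-idele is the same in every procession degree). [cite: DupuyHilado2025, Thm. 3.10.1] -/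
theorem lnνLp_region_tq_eq (p : ℕ) [Fact p.Prime] :
    D.M.lnνLp D.X.lstar p (D.M.region D.tq) =
      -FinDivisor.ndeg F (∑ v : placesOver F p, FinDivisor.of v.1 (D.X.qPilot v.1)) := by
  haveI : NeZero D.X.lstar := ⟨by have := D.X.two_le_lstar; omega⟩
  rw [D.M.lnνLp_region D.tq p]
  simp_rw [D.tq_ord]
  rw [Finset.sum_const, Finset.card_univ, Fintype.card_fin, nsmul_eq_mul]
  have hl : (D.X.lstar : ℝ) ≠ 0 := by exact_mod_cast (NeZero.ne D.X.lstar)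
  field_simp

/-- Plumbing: `Σ_{i<n} (i+1)² = n(n+1)(2n+1)/6` over `ℝ`. [folklore] -/
private theorem sum_succ_sq_aux (n : ℕ) :
    ∑ i ∈ Finset.range n, (((i : ℕ) : ℝ) + 1) ^ 2 = (n : ℝ) * (n + 1) * (2 * n + 1) / 6 := by
  induction n with
  | zero => simp
  | succ n ih => rw [Finset.sum_range_succ, ih]; push_cast; ring

/-- **`ln ν̄_{𝕃_p}(O_𝕃(−P_Θ)_p) = −c_l·Q_p`**, `c_l = (ℓ⋆+1)(2ℓ⋆+1)/6` the procession average of `j²` (Thm. 3.10.1 at one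
prime with `P_{Θ,j} = j²·P_q`, `PilotData.thetaPilot_eq_smul`). [cite: DupuyHilado2025, Thm. 3.10.1, §3.3] -/
theorem lnνLp_region_tΘ_eq (p : ℕ) [Fact p.Prime] :
    D.M.lnνLp D.X.lstar p (D.M.region D.tΘ) =
      -((((D.X.lstar : ℝ) + 1) * (2 * D.X.lstar + 1) / 6) *
        FinDivisor.ndeg F (∑ v : placesOver F p, FinDivisor.of v.1 (D.X.qPilot v.1))) := by
  haveI : NeZero D.X.lstar := ⟨by have := D.X.two_le_lstar; omega⟩
  rw [D.M.lnνLp_region D.tΘ p]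
  simp_rw [D.tΘ_ord]
  have hθ : ∀ (i : Fin D.X.lstar) (v : placesOver F p),
      D.X.thetaPilot i v.1 = (((i : ℕ) + 1 : ℝ) ^ 2) * D.X.qPilot v.1 := by
    intro i v
    rw [D.X.thetaPilot_eq_smul i, Finsupp.smul_apply, smul_eq_mul]
  have hlin : ∀ i : Fin D.X.lstar,
      FinDivisor.ndeg F (∑ v : placesOver F p, FinDivisor.of v.1 ((((i : ℕ) + 1 : ℝ) ^ 2) * D.X.qPilot v.1)) =
        (((i : ℕ) + 1 : ℝ) ^ 2) * FinDivisor.ndeg F (∑ v : placesOver F p, FinDivisor.of v.1 (D.X.qPilot v.1)) := by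
    intro i
    rw [← smul_eq_mul, ← map_smul, Finset.smul_sum]
    congr 1
    refine Finset.sum_congr rfl fun v _ => ?_
    rw [Finsupp.smul_single, smul_eq_mul]
  simp_rw [hθ, hlin]
  rw [← Finset.sum_mul, Fin.sum_univ_eq_sum_range (fun i => ((i : ℝ) + 1) ^ 2) D.X.lstar, sum_succ_sq_aux]
  have hl : (D.X.lstar : ℝ) ≠ 0 := by exact_mod_cast (NeZero.ne D.X.lstar)
  field_simp

/-- `c_l ≥ 5/2` (`ℓ⋆ ≥ 2`), so `c_l − 1 ≥ 3/2 > 0`: the Θ-pilot at `p` is at least `5/2` times as deep as the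
`q`-pilot. [cite: DupuyHilado2025, §3.3] -/
theorem five_halves_le_avgSq : (5 / 2 : ℝ) ≤ ((D.X.lstar : ℝ) + 1) * (2 * D.X.lstar + 1) / 6 := by
  have h2 : (2 : ℝ) ≤ D.X.lstar := by exact_mod_cast D.X.two_le_lstar
  nlinarith

/-- **The per-prime squeeze**: the PER-PRIME READING of (1.1)/Cor. 3.12 at `p` (`q`-pilot volume ≤ hull volume, `v_ℚ = p`
only) plus a Step (v)-shaped hull bound with discrepancy `δ` force `(c_l − 1)·Q_p ≤ δ`. Bookkeeping of Thm. 3.10.1 at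
`p`; no side taken. [cite: DupuyHilado2025, §1 (1.1), Thm. 3.10.1] [claim: Mochizuki2012, status: disputed] -/
theorem perPrime_gap_le {p : ℕ} [Fact p.Prime] {δ : ℝ}
    (hread : D.M.lnνLp D.X.lstar p (D.M.region D.tq) ≤ D.M.lnνLp D.X.lstar p (D.M.hullUTheta D.ind3))
    (hest : D.M.lnνLp D.X.lstar p (D.M.hullUTheta D.ind3) ≤ D.M.lnνLp D.X.lstar p (D.M.region D.tΘ) + δ) :
    ((((D.X.lstar : ℝ) + 1) * (2 * D.X.lstar + 1) / 6) - 1) *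
        FinDivisor.ndeg F (∑ v : placesOver F p, FinDivisor.of v.1 (D.X.qPilot v.1)) ≤ δ := by
  rw [D.lnνLp_region_tq_eq p] at hread
  rw [D.lnνLp_region_tΘ_eq p] at hest
  linarith

/-- **Per-PACKET ⇒ per-PRIME**: the reading in EVERY tensor degree `j` over `p` (R0 summed over the tuples of one
degree) gives it for the procession average `ln ν̄_{𝕃_p}`; so a per-prime FAILURE refutes every per-packet reading at
`p`. [cite: DupuyHilado2025, Def. 3.6.3] -/
theorem perPrimeReading_of_perPacketReading {p : ℕ}
    (h : ∀ i : Fin D.X.lstar, D.M.lnνTensorPower p ((i : ℕ) + 1) (D.M.region D.tq) ≤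
      D.M.lnνTensorPower p ((i : ℕ) + 1) (D.M.hullUTheta D.ind3)) :
    D.M.lnνLp D.X.lstar p (D.M.region D.tq) ≤ D.M.lnνLp D.X.lstar p (D.M.hullUTheta D.ind3) := by
  unfold PacketModel.lnνLp
  exact mul_le_mul_of_nonneg_left (Finset.sum_le_sum fun i _ => h i) (by positivity)

/-- Hence a per-prime failure exhibits a tensor degree `j` over `p` at which the per-packet reading fails.
[cite: DupuyHilado2025, Def. 3.6.3] -/
theorem exists_not_perPacketReading_of_not_perPrimeReading {p : ℕ}
    (h : ¬ D.M.lnνLp D.X.lstar p (D.M.region D.tq) ≤ D.M.lnνLp D.X.lstar p (D.M.hullUTheta D.ind3)) :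
    ∃ i : Fin D.X.lstar, D.M.lnνTensorPower p ((i : ℕ) + 1) (D.M.hullUTheta D.ind3) <
      D.M.lnνTensorPower p ((i : ℕ) + 1) (D.M.region D.tq) := by
  by_contra hne
  simp only [not_exists, not_lt] at hne
  exact h (D.perPrimeReading_of_perPacketReading hne)

/-! ## §2 The per-prime Step (v) bound for the idele-built datum `ofIdelesM` (any prime) -/

/-- **The explicit Step (v) discrepancy `δ(p, j, v⃗)`** of c312-d1's `componentBound_ofIdelesM` over a local-field
family `𝔽` (the integrand of `explicitDelta`, verbatim): `{θ_j(v_j) − min_a θ_j(v_a)} + {d_I + 1}·log p +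
Σ_{a : e_a > p−2} {3 + log e_a}` for `1 ≤ j ≤ ℓ⋆` at a prime, else `0`. [cite: Mochizuki2012, IUTchIV Thm. 1.10 Step (v) p. 27–28] -/
def stepVDelta (X : PilotData F) (𝔽 : LocalFieldFamily F) (p j : ℕ) (e : Fin (j + 1) → placesOver F p) : ℝ :=
  if h : p.Prime ∧ 0 < j ∧ j - 1 < X.lstar then
    haveI : Fact p.Prime := ⟨h.1⟩
    (X.thetaPilot ⟨j - 1, h.2.2⟩ (e (Fin.last j)).1 * logNorm F (e (Fin.last j)).1 / localDegree F (e (Fin.last j)).1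
      - Finset.univ.inf' ⟨0, Finset.mem_univ _⟩ (fun a =>
          X.thetaPilot ⟨j - 1, h.2.2⟩ (e a).1 * logNorm F (e a).1 / localDegree F (e a).1))
    + (dSum p (fun a => (𝔽 p h.1).k (e a)) + 1) * Real.log p
    + ∑ a ∈ Finset.univ.filter (fun a => p - 2 < absRamificationIdx p ((𝔽 p h.1).k (e a))),
        (3 + Real.log (absRamificationIdx p ((𝔽 p h.1).k (e a))))
  else 0

section IdelesM

variable (X : PilotData F) (𝔽 : LocalFieldFamily F)
  (tΘ : ∀ (p : ℕ) (hp : p.Prime), Fin X.lstar → (v : placesOver F p) → (@LocalFields.k F _ _ p ⟨hp⟩ (𝔽 p hp) v)ˣ)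
  (tΘ_ord : ∀ (p : ℕ) (hp : p.Prime) (i : Fin X.lstar) (v : placesOver F p),
    @LocalFields.ordv F _ _ p ⟨hp⟩ (𝔽 p hp) v (tΘ p hp i v) = X.thetaPilot i v.1)
  (tq : ∀ (p : ℕ) (hp : p.Prime), Fin X.lstar → (v : placesOver F p) → (@LocalFields.k F _ _ p ⟨hp⟩ (𝔽 p hp) v)ˣ)
  (tq_ord : ∀ (p : ℕ) (hp : p.Prime) (i : Fin X.lstar) (v : placesOver F p),
    @LocalFields.ordv F _ _ p ⟨hp⟩ (𝔽 p hp) v (tq p hp i v) = X.qPilot v.1)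
  (T : Finset ℕ) (T_prime : ∀ p ∈ T, p.Prime) (S_sub : ∀ v ∈ X.S, residueChar F v ∈ T)

/-- **Per-prime Step (v) bound for the idele-built datum, at ANY prime** (not only `p ∈ T`):
`ln ν̄_{𝕃_p}(hull(U_Θ)_p) ≤ ln ν̄_{𝕃_p}(O_𝕃(−P_Θ)_p) + (1/ℓ⋆)·Σ_j Σ_{v⃗} δ(p,j,v⃗)·Π_k Pr(v_k)` — `componentBound_ofIdelesM`
summed at `p` (per-prime form of `estimateDH_ofIdelesM`). [cite: Mochizuki2012, IUTchIV Thm. 1.10 Step (v) p. 27–28] -/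
theorem lnνLp_hullUTheta_le_ofIdelesM {p : ℕ} [hp : Fact p.Prime] :
    (ofIdelesM X 𝔽 tΘ tΘ_ord tq tq_ord T T_prime S_sub).M.lnνLp X.lstar p
        ((ofIdelesM X 𝔽 tΘ tΘ_ord tq tq_ord T T_prime S_sub).M.hullUTheta
          (ofIdelesM X 𝔽 tΘ tΘ_ord tq tq_ord T T_prime S_sub).ind3) ≤
      (ofIdelesM X 𝔽 tΘ tΘ_ord tq tq_ord T T_prime S_sub).M.lnνLp X.lstar p
          ((ofIdelesM X 𝔽 tΘ tΘ_ord tq tq_ord T T_prime S_sub).M.region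
            (ofIdelesM X 𝔽 tΘ tΘ_ord tq tq_ord T T_prime S_sub).tΘ) +
        (1 / (X.lstar : ℝ)) * ∑ i : Fin X.lstar, ∑ e : Fin ((i : ℕ) + 1 + 1) → placesOver F p,
          stepVDelta X 𝔽 p ((i : ℕ) + 1) e * ∏ k, weight F (e k).1 := by
  refine (ofIdelesM X 𝔽 tΘ tΘ_ord tq tq_ord T T_prime S_sub).M.lnνLp_le_add_sum (stepVDelta X 𝔽 p) ?_
  intro j hj1 hj2 e
  have hc : p.Prime ∧ 0 < j ∧ j - 1 < X.lstar := ⟨hp.out, hj1, by omega⟩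
  rw [stepVDelta, dif_pos hc]
  obtain ⟨i₀, -, hi₀⟩ := Finset.exists_min_image Finset.univ
    (fun a : Fin (j + 1) => X.thetaPilot ⟨j - 1, hc.2.2⟩ (e a).1 * logNorm F (e a).1 / localDegree F (e a).1)
    ⟨0, Finset.mem_univ _⟩
  have hcb := componentBound_ofIdelesM X 𝔽 tΘ tΘ_ord tq tq_ord T T_prime S_sub hj1 hj2 e
    (Finset.univ.filter (fun a => p - 2 < absRamificationIdx p ((𝔽 p hp.out).k (e a))))
    (fun a ha => by
      rw [Finset.mem_filter, not_and] at ha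
      exact Nat.le_of_not_lt (ha (Finset.mem_univ a)))
    i₀ (fun a => hi₀ a (Finset.mem_univ a))
  have hinf : Finset.univ.inf' ⟨0, Finset.mem_univ _⟩ (fun a : Fin (j + 1) =>
      X.thetaPilot ⟨j - 1, hc.2.2⟩ (e a).1 * logNorm F (e a).1 / localDegree F (e a).1) ≤
      X.thetaPilot ⟨j - 1, hc.2.2⟩ (e i₀).1 * logNorm F (e i₀).1 / localDegree F (e i₀).1 :=
    Finset.inf'_le _ (Finset.mem_univ i₀)
  linarith

end IdelesM

/-! ## §3 A genuine input: `−|log(q)|_p ≤ −|log(Θ)|_p` forces `(c_l − 1)·Q_p ≤ δ_p(I)` -/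

section Genuine

variable {K : Type} [Field K] [NumberField K] [Algebra F K] (I : ThetaVolumeInput F K)

/-- **`δ_p(I)`**, the `p`-summand of the explicit Step (v) discrepancy `δΣ(I) = explicitDelta I` over the genuine
completions `K_{v̲}`. [cite: Mochizuki2012, IUTchIV Thm. 1.10 Step (v) p. 27–28] -/
def explicitDeltaAt (p : ℕ) : ℝ :=
  (1 / (I.X.lstar : ℝ)) * ∑ i : Fin I.X.lstar, ∑ e : Fin ((i : ℕ) + 1 + 1) → placesOver F p,
    stepVDelta I.X I.σ.localFieldFamily p ((i : ℕ) + 1) e * ∏ k, weight F (e k).1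

/-- `δΣ(I) = Σ_{p ∈ T(I)} δ_p(I)` (definitional). [cite: Mochizuki2012, IUTchIV Thm. 1.10 Step (viii) p. 30] -/
theorem explicitDelta_eq_sum_explicitDeltaAt :
    explicitDelta I = ∑ p ∈ I.supportPrimes, explicitDeltaAt I p := rfl

/-- **Per-prime computable half for a genuine input, at ANY prime**: `negLogThetaLoc p ≤ −c_l·Q_p + δ_p(I)`.
[cite: Mochizuki2012, IUTchIV Thm. 1.10 Step (v) p. 27–28] [claim: Mochizuki2012, status: disputed] -/
theorem negLogThetaLoc_le {p : ℕ} (hp : p.Prime) :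
    I.negLogThetaLoc p ≤
      -((((I.X.lstar : ℝ) + 1) * (2 * I.X.lstar + 1) / 6) *
          FinDivisor.ndeg F (∑ v : placesOver F p, FinDivisor.of v.1 (I.X.qPilot v.1))) +
        explicitDeltaAt I p := by
  haveI : Fact p.Prime := ⟨hp⟩
  have h2 : (ofInput I).M.lnνLp I.X.lstar p ((ofInput I).M.region (ofInput I).tΘ) =
      -((((I.X.lstar : ℝ) + 1) * (2 * I.X.lstar + 1) / 6) *
          FinDivisor.ndeg F (∑ v : placesOver F p, FinDivisor.of v.1 (I.X.qPilot v.1))) :=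
    (ofInput I).lnνLp_region_tΘ_eq p
  rw [← lnνLp_hullUTheta_ofInput I hp, ← h2]
  exact lnνLp_hullUTheta_le_ofIdelesM I.X I.σ.localFieldFamily I.tΘ I.tΘ_ord I.tq I.tq_ord I.supportPrimes
    (fun _ hp => I.prime_of_mem_supportPrimes hp) (fun _ hv => I.residueChar_mem_supportPrimes hv) (p := p)

/-- **`−|log(q)|_p = −Q_p`** for a genuine input (Thm. 3.10.1 at `P_q`, one prime). [cite: DupuyHilado2025, Thm. 3.10.1] -/
theorem negAbsLogQLoc_eq {p : ℕ} (hp : p.Prime) :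
    I.negAbsLogQLoc p = -FinDivisor.ndeg F (∑ v : placesOver F p, FinDivisor.of v.1 (I.X.qPilot v.1)) := by
  haveI : Fact p.Prime := ⟨hp⟩
  rw [← lnνLp_regionq_ofInput I hp]
  exact (ofInput I).lnνLp_region_tq_eq p

/-- **The per-prime squeeze for a genuine input**: the reading "`−|log(q)|_p ≤ −|log(Θ)|_p`" (HYPOTHESIS) forces
`(c_l − 1)·Q_p ≤ δ_p(I)`. [cite: DupuyHilado2025, §1 (1.1)] [claim: Mochizuki2012, status: disputed] -/
theorem perPrime_gap_le_of_reading {p : ℕ} (hp : p.Prime) (hread : I.negAbsLogQLoc p ≤ I.negLogThetaLoc p) :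
    ((((I.X.lstar : ℝ) + 1) * (2 * I.X.lstar + 1) / 6) - 1) *
        FinDivisor.ndeg F (∑ v : placesOver F p, FinDivisor.of v.1 (I.X.qPilot v.1)) ≤ explicitDeltaAt I p := by
  have h1 := negLogThetaLoc_le I hp
  rw [negAbsLogQLoc_eq I hp] at hread
  linarith

/-- **The per-prime reading fails at `p` once `δ_p(I) < (c_l − 1)·Q_p`.**
[cite: DupuyHilado2025, §1 (1.1)] [claim: Mochizuki2012, status: disputed] -/
theorem not_perPrimeReading_of_explicitDeltaAt_lt {p : ℕ} (hp : p.Prime)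
    (hδ : explicitDeltaAt I p < ((((I.X.lstar : ℝ) + 1) * (2 * I.X.lstar + 1) / 6) - 1) *
        FinDivisor.ndeg F (∑ v : placesOver F p, FinDivisor.of v.1 (I.X.qPilot v.1))) :
    ¬ I.negAbsLogQLoc p ≤ I.negLogThetaLoc p :=
  fun hread => not_le.mpr hδ (perPrime_gap_le_of_reading I hp hread)

/-! ## §4 One place of `F₀` over `p` (e.g. `F₀ = ℚ`): `δ_p(I)` is `ord(q)`-free, a deep `q_{v₀}` kills the reading -/

/-- Plumbing: `Σ_{i<n} (i+2) = n(n+3)/2` over `ℝ`. [folklore] -/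
private theorem sum_add_two_aux (n : ℕ) :
    ∑ i ∈ Finset.range n, (((i : ℕ) : ℝ) + 2) = (n : ℝ) * (n + 3) / 2 := by
  induction n with
  | zero => simp
  | succ n ih => rw [Finset.sum_range_succ, ih]; push_cast; ring

/-- With ONE place `v₀` of `F` over `p`, `Q_p = P_q(v₀)·ln N(v₀)/[F:ℚ]`. [cite: DupuyHilado2025, §2.5.4, §3.3] -/
theorem localQMass_eq_of_subsingleton {p : ℕ} (hp1 : ∀ v w : placesOver F p, v = w) (v₀ : placesOver F p) :
    FinDivisor.ndeg F (∑ v : placesOver F p, FinDivisor.of v.1 (I.X.qPilot v.1)) =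
      I.X.qPilot v₀.1 * logNorm F v₀.1 / Module.finrank ℚ F := by
  haveI : Subsingleton (placesOver F p) := ⟨hp1⟩
  rw [Fintype.sum_subsingleton _ v₀, FinDivisor.ndeg_of]

/-- With one place `v₀` over `p`, `Pr(v₀) = n_{v₀}/[F:ℚ] = 1` (fundamental identity). [cite: DupuyHilado2025, §3.6] -/
theorem weight_eq_one_of_subsingleton {p : ℕ} [Fact p.Prime] (hp1 : ∀ v w : placesOver F p, v = w)
    (v₀ : placesOver F p) : weight F v₀.1 = 1 := by
  have hset : placesOver F p = {v₀.1} := Finset.eq_singleton_iff_unique_mem.mpr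
    ⟨v₀.2, fun v hv => congrArg Subtype.val (hp1 ⟨v, hv⟩ v₀)⟩
  have h := sum_localDegree F p
  rw [hset, Finset.sum_singleton] at h
  have hF : (Module.finrank ℚ F : ℝ) ≠ 0 := by exact_mod_cast (Module.finrank_pos).ne'
  rw [weight, h, div_self hF]

/-- **One place `v₀` over `p`: the tuple sum of the Step (v) discrepancy in degree `j = i+1` is `ord(q)`-FREE** —
`Σ_{v⃗} δ(p,j,v⃗)·Π Pr ≤ ((j+1)·d₀ + 1)·log p + (j+1)·(3 + log e₀)` (`d₀`, `e₀` = different exponent / ramification index of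
the member of `𝔽` at `v₀`): the summand `θ_j(v_j) − min_a θ_j(v_a)` VANISHES (all slots carry `v₀`), `d_I = (j+1)·d₀`, the
tame sum is `≤ (j+1)(3 + log e₀)`, `Pr(v₀) = 1`. [cite: Mochizuki2012, IUTchIV Thm. 1.10 Step (v) p. 27–28] -/
theorem stepVDelta_sum_le_of_subsingleton (X : PilotData F) (𝔽 : LocalFieldFamily F) {p : ℕ} [hpi : Fact p.Prime]
    (hp1 : ∀ v w : placesOver F p, v = w) (v₀ : placesOver F p) (i : Fin X.lstar) :
    (∑ e : Fin ((i : ℕ) + 1 + 1) → placesOver F p, stepVDelta X 𝔽 p ((i : ℕ) + 1) e * ∏ k, weight F (e k).1) ≤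
      ((((i : ℕ) : ℝ) + 2) * differentOrd p ((𝔽 p hpi.out).k v₀) + 1) * Real.log p
        + (((i : ℕ) : ℝ) + 2) * (3 + Real.log (absRamificationIdx p ((𝔽 p hpi.out).k v₀))) := by
  have hp : p.Prime := hpi.out
  haveI : Subsingleton (placesOver F p) := ⟨hp1⟩
  set d₀ := differentOrd p ((𝔽 p hp).k v₀) with hd₀
  set e₀ := absRamificationIdx p ((𝔽 p hp).k v₀) with he₀
  have hw : weight F v₀.1 = 1 := weight_eq_one_of_subsingleton hp1 v₀
  have hC : 0 ≤ 3 + Real.log (e₀ : ℝ) := by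
    linarith [Real.log_nonneg (show (1 : ℝ) ≤ e₀ by exact_mod_cast absRamificationIdx_pos p _)]
  rw [Fintype.sum_subsingleton _ (fun _ => v₀)]
  have hc : p.Prime ∧ 0 < (i : ℕ) + 1 ∧ (i : ℕ) + 1 - 1 < X.lstar := ⟨hp, Nat.succ_pos _, by simp [i.2]⟩
  simp only [stepVDelta, dif_pos hc, Finset.inf'_const, sub_self, zero_add, Finset.prod_const, hw, one_pow, mul_one]
  have hd : dSum p (fun _ : Fin ((i : ℕ) + 1 + 1) => (𝔽 p hp).k v₀) = (((i : ℕ) : ℝ) + 2) * d₀ := by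
    rw [dSum, Finset.sum_const, Finset.card_univ, Fintype.card_fin, nsmul_eq_mul]
    push_cast; ring
  have ht : (∑ a ∈ Finset.univ.filter (fun _ : Fin ((i : ℕ) + 1 + 1) => p - 2 < absRamificationIdx p ((𝔽 p hp).k v₀)),
        (3 + Real.log (absRamificationIdx p ((𝔽 p hp).k v₀) : ℝ))) ≤ (((i : ℕ) : ℝ) + 2) * (3 + Real.log (e₀ : ℝ)) := by
    refine (Finset.sum_le_sum_of_subset_of_nonneg (Finset.filter_subset _ _) fun _ _ _ => hC).trans ?_
    rw [Finset.sum_const, Finset.card_univ, Fintype.card_fin, nsmul_eq_mul]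
    push_cast
    nlinarith
  have hlogp : 0 ≤ Real.log p := Real.log_nonneg (by exact_mod_cast hp.one_lt.le)
  rw [hd]
  linarith

/-- **With ONE place `v₀` of `F` over `p`, `δ_p(I) ≤ D_p(I) := ((ℓ⋆+3)/2·d₀ + 1)·log p + ((ℓ⋆+3)/2)·(3 + log e₀)`**, an
`ord(q)`-FREE constant (`d₀`, `e₀` = different exponent / ramification index of `K_{v̲₀}`): the degreewise bound
`stepVDelta_sum_le_of_subsingleton` averaged with `(1/ℓ⋆)·Σ_j (j+1) = (ℓ⋆+3)/2`. [cite: Mochizuki2012, IUTchIV Thm. 1.10 Step (v) p. 27–28] -/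
theorem explicitDeltaAt_le_of_subsingleton {p : ℕ} [hpi : Fact p.Prime] (hp1 : ∀ v w : placesOver F p, v = w)
    (v₀ : placesOver F p) :
    explicitDeltaAt I p ≤
      (((I.X.lstar : ℝ) + 3) / 2 * differentOrd p ((I.σ.localFieldFamily p hpi.out).k v₀) + 1) * Real.log p
        + ((I.X.lstar : ℝ) + 3) / 2 *
          (3 + Real.log (absRamificationIdx p ((I.σ.localFieldFamily p hpi.out).k v₀))) := by
  haveI : NeZero I.X.lstar := ⟨by have := I.X.two_le_lstar; omega⟩
  set d₀ := differentOrd p ((I.σ.localFieldFamily p hpi.out).k v₀) with hd₀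
  set e₀ := absRamificationIdx p ((I.σ.localFieldFamily p hpi.out).k v₀) with he₀
  have inner := stepVDelta_sum_le_of_subsingleton I.X I.σ.localFieldFamily hp1 v₀
  -- sum over the procession index
  have hsum := Finset.sum_le_sum fun i (_ : i ∈ (Finset.univ : Finset (Fin I.X.lstar))) => inner i
  have hclosed : ∑ i : Fin I.X.lstar,
        (((((i : ℕ) : ℝ) + 2) * d₀ + 1) * Real.log p + (((i : ℕ) : ℝ) + 2) * (3 + Real.log (e₀ : ℝ))) =
      (I.X.lstar : ℝ) * (I.X.lstar + 3) / 2 * (d₀ * Real.log p + (3 + Real.log (e₀ : ℝ)))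
        + I.X.lstar * Real.log p := by
    have hC2 : ∀ x : ℝ, (x * d₀ + 1) * Real.log p + x * (3 + Real.log (e₀ : ℝ)) =
        x * (d₀ * Real.log p + (3 + Real.log (e₀ : ℝ))) + Real.log p := fun x => by ring
    simp_rw [hC2]
    rw [Finset.sum_add_distrib, ← Finset.sum_mul, Fin.sum_univ_eq_sum_range (fun i => ((i : ℝ) + 2)) I.X.lstar,
      sum_add_two_aux, Finset.sum_const, Finset.card_univ, Fintype.card_fin, nsmul_eq_mul]
  have hl : (I.X.lstar : ℝ) ≠ 0 := by exact_mod_cast (NeZero.ne I.X.lstar)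
  calc explicitDeltaAt I p
      ≤ (1 / (I.X.lstar : ℝ)) * ((I.X.lstar : ℝ) * (I.X.lstar + 3) / 2 * (d₀ * Real.log p + (3 + Real.log (e₀ : ℝ)))
          + I.X.lstar * Real.log p) :=
        mul_le_mul_of_nonneg_left (hsum.trans hclosed.le) (by positivity)
    _ = _ := by
        field_simp
        ring

/-- `P_q(v) = ord_v(q_v)/(2l)` at a bad place `v ∈ S`. [cite: DupuyHilado2025, §3.3] -/
theorem qPilot_apply_of_mem {v : HeightOneSpectrum (𝓞 F)} (hv : v ∈ I.X.S) :
    I.X.qPilot v = (I.X.ordq v : ℝ) / (2 * I.X.l) := by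
  classical
  show (∑ u ∈ I.X.S, FinDivisor.of u ((I.X.ordq u : ℝ) / (2 * I.X.l))) v = _
  rw [Finsupp.finsetSum_apply, Finset.sum_eq_single v]
  · exact Finsupp.single_eq_same
  · intro u _ huv
    exact Finsupp.single_eq_of_ne (Ne.symm huv)
  · intro h; exact absurd hv h

/-- **THE PER-PRIME READING OF (1.1)/[IUTchIII] COR. 3.12 FAILS AT A DEEP BAD PRIME** (ONE place `v₀` of `F₀` over `p`,
e.g. `F₀ = ℚ`): `D_p(I) < (c_l − 1)·P_q(v₀)·ln N(v₀)/[F₀:ℚ]` gives `¬ (−|log(q)|_p ≤ −|log(Θ)|_p)` for the GENUINE input —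
so every per-packet reading fails at `p` (`exists_not_perPacketReading_of_not_perPrimeReading` for `ofInput I`),
whatever the global `Cor312Of I` does; skeleton §3 as a theorem at the L-DH level. [cite: Mochizuki2012, IUTchIV Thm.
1.10 Step (v) p. 27–28] [cite: DupuyHilado2025, §1 (1.1), Thm. 3.10.1] [claim: Mochizuki2012, status: disputed] -/
theorem not_perPrimeReading_of_deep {p : ℕ} [hpi : Fact p.Prime] (hp1 : ∀ v w : placesOver F p, v = w)
    (v₀ : placesOver F p)
    (hdeep : (((I.X.lstar : ℝ) + 3) / 2 * differentOrd p ((I.σ.localFieldFamily p hpi.out).k v₀) + 1) * Real.log p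
        + ((I.X.lstar : ℝ) + 3) / 2 *
          (3 + Real.log (absRamificationIdx p ((I.σ.localFieldFamily p hpi.out).k v₀))) <
      ((((I.X.lstar : ℝ) + 1) * (2 * I.X.lstar + 1) / 6) - 1) *
        (I.X.qPilot v₀.1 * logNorm F v₀.1 / Module.finrank ℚ F)) :
    ¬ I.negAbsLogQLoc p ≤ I.negLogThetaLoc p := by
  refine not_perPrimeReading_of_explicitDeltaAt_lt I hpi.out ?_
  rw [localQMass_eq_of_subsingleton I hp1 v₀]
  exact (explicitDeltaAt_le_of_subsingleton I hp1 v₀).trans_lt hdeep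

/-- The same with `P_q(v₀) = ord_{v₀}(q_{v₀})/(2l)` (`v₀ ∈ S`): failure at `p` once `(c_l − 1)·ord_{v₀}(q_{v₀})·ln N(v₀)/
(2l·[F₀:ℚ]) > D_p(I)` — a threshold linear in `ord_{v₀}(q_{v₀})` against a constant in `p`, `l` and the local different /
ramification of `K_{v̲₀}`. [cite: Mochizuki2012, IUTchIV Thm. 1.10 Step (v) p. 27–28] [claim: Mochizuki2012, status: disputed] -/
theorem not_perPrimeReading_of_ordq_large {p : ℕ} [hpi : Fact p.Prime] (hp1 : ∀ v w : placesOver F p, v = w)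
    (v₀ : placesOver F p) (hv₀ : v₀.1 ∈ I.X.S)
    (hdeep : (((I.X.lstar : ℝ) + 3) / 2 * differentOrd p ((I.σ.localFieldFamily p hpi.out).k v₀) + 1) * Real.log p
        + ((I.X.lstar : ℝ) + 3) / 2 *
          (3 + Real.log (absRamificationIdx p ((I.σ.localFieldFamily p hpi.out).k v₀))) <
      ((((I.X.lstar : ℝ) + 1) * (2 * I.X.lstar + 1) / 6) - 1) *
        ((I.X.ordq v₀.1 : ℝ) / (2 * I.X.l) * logNorm F v₀.1 / Module.finrank ℚ F)) :
    ¬ I.negAbsLogQLoc p ≤ I.negLogThetaLoc p := by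
  refine not_perPrimeReading_of_deep I hp1 v₀ ?_
  rwa [qPilot_apply_of_mem I hv₀]

/-- **Degree-one base field (`F₀ ≃ ℚ`, the summit route's `F_mod = ℚ`)**: there is ONE place over every prime
(`ValLine.placesOver_subsingleton_of_finrank_eq_one`), so the per-prime reading at a bad prime `p` under `v₀ ∈ S` fails once
`(c_l − 1)·ord_{v₀}(q_{v₀})·ln N(v₀)/(2l) > D_p(I)`. [cite: Mochizuki2012, IUTchIV Thm. 1.10 Step (v) p. 27–28] [claim: Mochizuki2012, status: disputed] -/
theorem not_perPrimeReading_of_ordq_large_of_finrank_eq_one (hF : Module.finrank ℚ F = 1) {p : ℕ} [hpi : Fact p.Prime]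
    (v₀ : placesOver F p) (hv₀ : v₀.1 ∈ I.X.S)
    (hdeep : (((I.X.lstar : ℝ) + 3) / 2 * differentOrd p ((I.σ.localFieldFamily p hpi.out).k v₀) + 1) * Real.log p
        + ((I.X.lstar : ℝ) + 3) / 2 *
          (3 + Real.log (absRamificationIdx p ((I.σ.localFieldFamily p hpi.out).k v₀))) <
      ((((I.X.lstar : ℝ) + 1) * (2 * I.X.lstar + 1) / 6) - 1) *
        ((I.X.ordq v₀.1 : ℝ) / (2 * I.X.l) * logNorm F v₀.1)) :
    ¬ I.negAbsLogQLoc p ≤ I.negLogThetaLoc p := by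
  refine not_perPrimeReading_of_ordq_large I (ValLine.placesOver_subsingleton_of_finrank_eq_one hF p) v₀ hv₀ ?_
  rwa [hF, Nat.cast_one, div_one]

end Genuine

end Summit.ABC.IUTFork.DHData

end
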